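import Literature.AlgebraicGeometry.RealAlgebraic.DividingCurves
import Literature.ModelTheory.ExponentialFields.SemialgebraicComponents
import HarnessLib

/-!
# Halves of real algebraic curves are semialgebraic over the field of coefficients

Topic `Literature/AlgebraicGeometry/RealAlgebraic`. For a polynomial `p : MvPolynomial (Fin n) R`
with coefficients mapped into `ℝ ⊆ ℂ` (`[Algebra R ℝ] [IsScalarTower R ℝ ℂ]`, e.g. `R = ℚ`), the
complex zero locus, the non-real locus and every **half** (connected component of the non-real
locus, `Literature.AlgebraicGeometry.RealAlgebraic.IsHalf`) become, in the real coordinates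
`(Re w, Im w) ∈ ℝⁿ⁺ⁿ` of `ℂⁿ`, `R`-semialgebraic subsets of `ℝⁿ⁺ⁿ`
(`Literature.ModelTheory.ExponentialFields.IsSemialgebraic R`). This is what makes a half `H₊` of a
dividing curve over `ℚ` a legal carrier of Kontsevich–Zagier moves (route
`KontsevichZagierPeriods/ComplexOrientations`): `IsHalf.isSemialgebraic_image_reIm`.

Ingredients: the real and imaginary parts of `p(u + iv)` are polynomials over `R` in `(u, v)`
(`exists_re_im_mvPolynomial`, induction on `p`), so the loci are cut out by polynomial
(in)equations over `R`; connected components of `R`-semialgebraic sets are `R`-semialgebraic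
(`IsSemialgebraic.isSemialgebraic_connectedComponentIn`, [BasuPollackRoy2006, Thm. 5.22]); and
`reIm` is a homeomorphism, so it maps halves to connected components (`image_reIm_half`).

The coordinates `reIm`/`ofReIm` (`Fin.append` of real and imaginary parts) are the same convention
as `Literature.AlgebraicGeometry.HodgeTheory.ProjSemialg.realify`/`complexify`, re-declared here in
three lines to keep real algebraic curves independent of the Hodge-theory files.

## References

* [BasuPollackRoy2006] S. Basu, R. Pollack, M.-F. Roy, *Algorithms in Real Algebraic Geometry*
  (2006), Thm. 5.22.
* [BochnakCosteRoy1998] J. Bochnak, M. Coste, M.-F. Roy, *Real Algebraic Geometry* (1998),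
  Def. 2.1.4 (semialgebraic sets), §2.4.
* [DegtyarevKharlamov2000] A. Degtyarev, V. Kharlamov, *Topological properties of real algebraic
  varieties: du côté de chez Rokhlin* (2000), §1 (halves of a dividing curve).
-/

noncomputable section

open MvPolynomial Set
open Literature.ModelTheory.ExponentialFields (IsSemialgebraic isSemialgebraic_setOf_eval_eq_zero
  isSemialgebraic_setOf_eval_ne_zero)

namespace Literature.AlgebraicGeometry.RealAlgebraic

variable {n : ℕ}

/-! ### Real coordinates on `ℂⁿ` -/

/-- Real coordinates `ℂⁿ → ℝⁿ⁺ⁿ`, `w ↦ (Re w, Im w)` (the convention of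
`Literature.AlgebraicGeometry.HodgeTheory.ProjSemialg.realify`). [folklore] -/
def reIm (w : Fin n → ℂ) : Fin (n + n) → ℝ :=
  Fin.append (fun i => (w i).re) (fun i => (w i).im)

/-- The inverse identification `ℝⁿ⁺ⁿ → ℂⁿ`, `x ↦ (x_i + i x_{n+i})_i`. [folklore] -/
def ofReIm (x : Fin (n + n) → ℝ) : Fin n → ℂ :=
  fun i => ⟨x (Fin.castAdd n i), x (Fin.natAdd n i)⟩

/-- First block of `reIm`: real parts. [folklore] -/
@[simp] theorem reIm_castAdd (w : Fin n → ℂ) (i : Fin n) : reIm w (Fin.castAdd n i) = (w i).re := by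
  simp only [reIm, Fin.append_left]

/-- Second block of `reIm`: imaginary parts. [folklore] -/
@[simp] theorem reIm_natAdd (w : Fin n → ℂ) (i : Fin n) : reIm w (Fin.natAdd n i) = (w i).im := by
  simp only [reIm, Fin.append_right]

/-- Real part of `ofReIm`. [folklore] -/
@[simp] theorem ofReIm_apply_re (x : Fin (n + n) → ℝ) (i : Fin n) :
    (ofReIm x i).re = x (Fin.castAdd n i) := rfl

/-- Imaginary part of `ofReIm`. [folklore] -/
@[simp] theorem ofReIm_apply_im (x : Fin (n + n) → ℝ) (i : Fin n) :
    (ofReIm x i).im = x (Fin.natAdd n i) := rfl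

/-- `ofReIm ∘ reIm = id`. [folklore] -/
@[simp] theorem ofReIm_reIm (w : Fin n → ℂ) : ofReIm (reIm w) = w := by
  funext i
  exact Complex.ext (by rw [ofReIm_apply_re, reIm_castAdd]) (by rw [ofReIm_apply_im, reIm_natAdd])

/-- `reIm ∘ ofReIm = id`. [folklore] -/
@[simp] theorem reIm_ofReIm (x : Fin (n + n) → ℝ) : reIm (ofReIm x) = x := by
  funext j
  refine Fin.addCases (fun i => ?_) (fun i => ?_) j
  · rw [reIm_castAdd, ofReIm_apply_re]
  · rw [reIm_natAdd, ofReIm_apply_im]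

/-- `reIm` is continuous. [folklore] -/
theorem continuous_reIm : Continuous (reIm : (Fin n → ℂ) → Fin (n + n) → ℝ) := by
  refine continuous_pi fun j => ?_
  refine Fin.addCases (fun i => ?_) (fun i => ?_) j
  · simp only [reIm_castAdd]
    exact Complex.continuous_re.comp (continuous_apply i)
  · simp only [reIm_natAdd]
    exact Complex.continuous_im.comp (continuous_apply i)

/-- `ofReIm` is continuous. [folklore] -/
theorem continuous_ofReIm : Continuous (ofReIm : (Fin (n + n) → ℝ) → Fin n → ℂ) := by
  refine continuous_pi fun i => ?_
  rw [← Complex.equivRealProdCLM.toHomeomorph.comp_continuous_iff]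
  exact ((continuous_apply (Fin.castAdd n i)).prodMk (continuous_apply (Fin.natAdd n i))).congr
    fun x => rfl

/-- Real coordinates as a homeomorphism `ℂⁿ ≃ₜ ℝⁿ⁺ⁿ`. [folklore] -/
def reImHomeomorph (n : ℕ) : (Fin n → ℂ) ≃ₜ (Fin (n + n) → ℝ) where
  toFun := reIm
  invFun := ofReIm
  left_inv := ofReIm_reIm
  right_inv := reIm_ofReIm
  continuous_toFun := continuous_reIm
  continuous_invFun := continuous_ofReIm

/-- `reImHomeomorph` is `reIm`. [folklore] -/
@[simp] theorem coe_reImHomeomorph : ⇑(reImHomeomorph n) = reIm := rfl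

/-- Images under `reIm` are preimages under `ofReIm`. [folklore] -/
theorem image_reIm_eq_preimage_ofReIm (S : Set (Fin n → ℂ)) : reIm '' S = ofReIm ⁻¹' S := by
  ext x
  constructor
  · rintro ⟨w, hw, rfl⟩
    rwa [mem_preimage, ofReIm_reIm]
  · intro hx
    exact ⟨ofReIm x, hx, reIm_ofReIm x⟩

/-! ### Real and imaginary parts of a polynomial with real coefficients -/

variable {R : Type*} [CommRing R] [Algebra R ℝ] [Algebra R ℂ] [IsScalarTower R ℝ ℂ]

/-- **Real and imaginary parts of `p(u + iv)`**: for `p` with coefficients mapped through `ℝ`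
there are polynomials `P`, `Q` over `R` in the `n + n` real coordinates with
`p(ofReIm x) = P(x) + i Q(x)`. [folklore] -/
theorem exists_re_im_mvPolynomial (p : MvPolynomial (Fin n) R) :
    ∃ P Q : MvPolynomial (Fin (n + n)) R, ∀ x : Fin (n + n) → ℝ,
      aeval (ofReIm x) p = ((aeval x P : ℝ) : ℂ) + ((aeval x Q : ℝ) : ℂ) * Complex.I := by
  induction p using MvPolynomial.induction_on with
  | C c =>
    refine ⟨C c, 0, fun x => ?_⟩
    simp only [algHom_C, map_zero, Complex.ofReal_zero, zero_mul, add_zero]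
    exact IsScalarTower.algebraMap_apply R ℝ ℂ c
  | add p q hp hq =>
    obtain ⟨P₁, Q₁, h₁⟩ := hp
    obtain ⟨P₂, Q₂, h₂⟩ := hq
    refine ⟨P₁ + P₂, Q₁ + Q₂, fun x => ?_⟩
    rw [map_add, h₁ x, h₂ x, map_add, map_add]
    push_cast
    ring
  | mul_X p i hp =>
    obtain ⟨P, Q, h⟩ := hp
    refine ⟨P * X (Fin.castAdd n i) - Q * X (Fin.natAdd n i),
      P * X (Fin.natAdd n i) + Q * X (Fin.castAdd n i), fun x => ?_⟩
    have hXi : aeval (ofReIm x) (X i : MvPolynomial (Fin n) R) =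
        ((x (Fin.castAdd n i) : ℝ) : ℂ) + ((x (Fin.natAdd n i) : ℝ) : ℂ) * Complex.I := by
      rw [aeval_X]
      exact Complex.ext (by simp [ofReIm]) (by simp [ofReIm])
    rw [map_mul, h x, hXi]
    simp only [map_sub, map_add, map_mul, aeval_X]
    push_cast
    ring_nf
    rw [Complex.I_sq]
    ring

/-- **The complex zero locus of a real polynomial is semialgebraic over the coefficients** (in
real coordinates: `Re p = Im p = 0`). [cite: BochnakCosteRoy1998, Def. 2.1.4] -/
theorem isSemialgebraic_image_reIm_complexZeroLocus (p : MvPolynomial (Fin n) R) :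
    IsSemialgebraic R (reIm '' complexZeroLocus p) := by
  obtain ⟨P, Q, h⟩ := exists_re_im_mvPolynomial p
  have hset : reIm '' complexZeroLocus p =
      {x | aeval x P = 0} ∩ {x : Fin (n + n) → ℝ | aeval x Q = 0} := by
    rw [image_reIm_eq_preimage_ofReIm]
    ext x
    simp only [mem_preimage, mem_complexZeroLocus_iff, h x, mem_inter_iff, mem_setOf_eq]
    constructor
    · intro h0
      have hre := congrArg Complex.re h0
      have him := congrArg Complex.im h0
      simp at hre him
      exact ⟨hre, him⟩
    · rintro ⟨h1, h2⟩
      rw [h1, h2]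
      simp
  rw [hset]
  exact (isSemialgebraic_setOf_eval_eq_zero P).inter (isSemialgebraic_setOf_eval_eq_zero Q)

/-- **The non-real locus of a real polynomial is semialgebraic over the coefficients** (in real
coordinates: `Re p = Im p = 0` and some `Im wᵢ ≠ 0`). [cite: BochnakCosteRoy1998, Def. 2.1.4] -/
theorem isSemialgebraic_image_reIm_nonRealLocus (p : MvPolynomial (Fin n) R) :
    IsSemialgebraic R (reIm '' nonRealLocus p) := by
  classical
  have hset : reIm '' nonRealLocus p = reIm '' complexZeroLocus p ∩
      ⋃ i ∈ (Finset.univ : Finset (Fin n)),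
        {x : Fin (n + n) → ℝ | aeval x (X (Fin.natAdd n i) : MvPolynomial (Fin (n + n)) R) ≠ 0} := by
    rw [image_reIm_eq_preimage_ofReIm, image_reIm_eq_preimage_ofReIm]
    ext x
    simp only [mem_preimage, mem_nonRealLocus_iff, mem_complexZeroLocus_iff, mem_inter_iff,
      mem_iUnion, Finset.mem_univ, exists_true_left, mem_setOf_eq, aeval_X, ofReIm_apply_im, ne_eq]
  rw [hset]
  exact (isSemialgebraic_image_reIm_complexZeroLocus p).inter
    (IsSemialgebraic.biUnion _ _ fun i _ => isSemialgebraic_setOf_eval_ne_zero _)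

omit [Algebra R ℝ] [IsScalarTower R ℝ ℂ] in
/-- **`reIm` maps halves to connected components** of the realified non-real locus. [folklore] -/
theorem image_reIm_half (p : MvPolynomial (Fin n) R) (w : Fin n → ℂ) :
    reIm '' half p w = connectedComponentIn (reIm '' nonRealLocus p) (reIm w) := by
  by_cases hw : w ∈ nonRealLocus p
  · exact (reImHomeomorph n).image_connectedComponentIn (s := nonRealLocus p) hw
  · rw [half_eq_empty hw, image_empty, connectedComponentIn_eq_empty]
    rw [image_reIm_eq_preimage_ofReIm, mem_preimage, ofReIm_reIm]
    exact hw

/-- **Halves are semialgebraic over the coefficients**: in real coordinates, the half through any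
point is an `R`-semialgebraic subset of `ℝⁿ⁺ⁿ` (a connected component of an `R`-semialgebraic
set, [BasuPollackRoy2006, Thm. 5.22]). [cite: BasuPollackRoy2006, Thm. 5.22] -/
theorem isSemialgebraic_image_reIm_half (p : MvPolynomial (Fin n) R) (w : Fin n → ℂ) :
    IsSemialgebraic R (reIm '' half p w) := by
  rw [image_reIm_half]
  exact (isSemialgebraic_image_reIm_nonRealLocus p).isSemialgebraic_connectedComponentIn _

/-- **Halves of a real curve are semialgebraic over the field of coefficients** (so that a half
`H₊` of a dividing curve over `ℚ` is a `ℚ`-semialgebraic carrier in `ℝ⁴`).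
[cite: BasuPollackRoy2006, Thm. 5.22] -/
theorem IsHalf.isSemialgebraic_image_reIm {p : MvPolynomial (Fin n) R} {H : Set (Fin n → ℂ)}
    (hH : IsHalf p H) : IsSemialgebraic R (reIm '' H) := by
  obtain ⟨w, -, rfl⟩ := hH
  exact isSemialgebraic_image_reIm_half p w

/-- **Finitely many halves**: the non-real locus of a real polynomial has finitely many connected
components. [cite: BasuPollackRoy2006, Thm. 5.22] -/
theorem finite_setOf_isHalf (p : MvPolynomial (Fin n) R) : {H | IsHalf p H}.Finite := by
  have hfin := (isSemialgebraic_image_reIm_nonRealLocus p).finite_setOf_connectedComponentIn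
  have hinj : Set.InjOn (fun H : Set (Fin n → ℂ) => reIm '' H) {H | IsHalf p H} :=
    fun H _ H' _ hHH' => (reImHomeomorph n).injective.image_injective hHH'
  refine Set.Finite.of_finite_image (hfin.subset ?_) hinj
  rintro _ ⟨H, ⟨w, hw, rfl⟩, rfl⟩
  refine ⟨reIm w, ⟨w, hw, rfl⟩, ?_⟩
  exact image_reIm_half p w

end Literature.AlgebraicGeometry.RealAlgebraic
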